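import Literature.NumberTheory.Automorphic.UnitaryGroupHeisenbergConjThreeFactor
import Literature.NumberTheory.Automorphic.BorelStabilizerLattice
import HarnessLib

/-!
# The finite part of a Heisenberg element of `U(3)` lies in the principal congruence level `K(𝔫)` once its
# off-diagonal entries are divisible by `𝔫`; conjugation by `GL₃(𝒪̂_E)` keeps it there
(Rogawski, *Automorphic Representations of Unitary Groups in Three Variables* (1990), §2.2; Shimura (1971), Ch. 3)

Topic `NumberTheory/Automorphic`; namespace `Literature.NumberTheory.Automorphic.UnitaryGroup`.  THEOREMS ONLY (kernel lane): no `def`,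
no named fact, no instance, no notation, no `sorry`.  Row H5b (FILE 2C, the LEVEL part of the three-factor normal form) of the T1-qs sub-line of
`F0_T1InnerFormTraceIdentity` (cell hodgecm-mathlib, F0P3a RULING #100 (a)): in ★ `adelicVal_borel_mul_conj_eq_threeFactor` (FILE 2A) the finite factor is
`ιf(κ_f⁻¹ h κ_f)` with `h = (π w)_f`, `w = b⁻¹ub ∈ N(𝔸_F)`; here we show `ιf(κ_f⁻¹ h κ_f) ∈ K(𝔫) = principalCongruenceLevel 3 E 𝔫` as soon as the
off-diagonal entries of `π w` and their conjugates are divisible by `𝔫` at every finite place and `κ_f ∈ GL₃(𝒪̂_E)`.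

* §1 `mem_valuedCongruenceSubgroup_of_entries` — a local criterion: `g ∈ K_v(r)` (`r ≤ 1`) for `g ∈ GL₃(E_v)` upper unitriangular together with `g⁻¹`,
  once the off-diagonal entries of `g` and `g⁻¹` have valuation `≤ r`.
* §2 **`sndHom_adelicVal_mem_comap_principalCongruenceLevel`** — for `w ∈ N(𝔸_F)`: if every off-diagonal entry `e` of `π w` satisfies `|e_v| ≤ |𝔫|_v` and
  `|c(e)_v| ≤ |𝔫|_v` for all finite `v` (the entries of `(π w)⁻¹ = J ᵗc(π w) J` are conjugates of entries of `π w`, ★ `coe_inv_apply_of_mem_unitaryGroupOfForm_antidiagonal`),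
  then `(π w)_f ∈ K_f(𝔫)`; **`ofFinite_conj_sndHom_mem_principalCongruenceLevel`** — and `ιf(κ_f⁻¹ (π w)_f κ_f) ∈ K(𝔫)` for `κ_f ∈ GL₃(𝒪̂_E)`
  (★ `BigHeckeGLn.conj_mem_comap_principalCongruenceLevel`: `K_f(𝔫) ⊲ GL₃(𝒪̂)`).
* §3 `valued_conjAdele_snd_le_of_smul_eq` — for a `c`-stable ideal (`c • 𝔫 = 𝔫`) the conjugate condition follows from the plain one
  (`|c(e)_v| = |e_{c⁻¹v}|`, ★ `valued_galAdicCompletionMap`, and `|𝔫|_{c⁻¹ v} = |𝔫|_v`); `sndHom_adelicVal_mem_comap_principalCongruenceLevel_of_smul_eq`.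

## References
* J. D. Rogawski, *Automorphic Representations of Unitary Groups in Three Variables*, Ann. of Math. Stud. 123 (1990), §2.2 [Rogawski1990].
* G. Shimura, *Introduction to the arithmetic theory of automorphic functions* (1971), Ch. 3 [ShimuraIATAF1971].
-/

set_option autoImplicit false

noncomputable section

open Matrix NumberField IsDedekindDomain
open scoped MatrixGroups Pointwise

namespace Literature.NumberTheory.Automorphic

namespace UnitaryGroup

open BigHeckeGLn

variable {F E : Type} [Field F] [NumberField F] [Field E] [NumberField E] [Algebra F E]
  {c : E ≃ₐ[F] E}

/-! ## §1 A local criterion for `K_v(r)` -/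

/-- **Local criterion**: `g ∈ K_v(r)` for `r ≤ 1` once `g` and `g⁻¹` have diagonal entries `1`, vanishing entries below the diagonal, and off-diagonal entries of
valuation `≤ r`. [cite: ShimuraIATAF1971, Ch. 3] -/
theorem mem_valuedCongruenceSubgroup_of_entries {L : Type*} [Field L] {Γ₀ : Type*} [LinearOrderedCommGroupWithZero Γ₀] [Valued L Γ₀]
    {r : Γ₀} (hr : r ≤ 1) {g : GL (Fin 3) L}
    (hdiag : ∀ i, (g : Matrix (Fin 3) (Fin 3) L) i i = 1) (hdiag' : ∀ i, ((g⁻¹ : GL (Fin 3) L) : Matrix (Fin 3) (Fin 3) L) i i = 1)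
    (hoff : ∀ i j, i ≠ j → Valued.v ((g : Matrix (Fin 3) (Fin 3) L) i j) ≤ r)
    (hoff' : ∀ i j, i ≠ j → Valued.v (((g⁻¹ : GL (Fin 3) L) : Matrix (Fin 3) (Fin 3) L) i j) ≤ r) :
    g ∈ valuedCongruenceSubgroup (Fin 3) r := by
  rw [mem_valuedCongruenceSubgroup_iff]
  refine ⟨fun i j => ?_, fun i j => ?_, fun i j => ?_⟩
  · rcases eq_or_ne i j with rfl | hij
    · rw [hdiag]; simp
    · exact (hoff i j hij).trans hr
  · rcases eq_or_ne i j with rfl | hij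
    · rw [hdiag']; simp
    · exact (hoff' i j hij).trans hr
  · rw [Matrix.sub_apply, Matrix.one_apply]
    rcases eq_or_ne i j with rfl | hij
    · rw [hdiag, if_pos rfl, sub_self]; simp
    · rw [if_neg hij, sub_zero]; exact hoff i j hij

/-! ## §2 The finite part of `π w`, `w ∈ N(𝔸_F)`, and its `GL₃(𝒪̂)`-conjugates lie in `K(𝔫)` -/

/-- The diagonal entries of `π w` are `1` and the entries below the diagonal vanish (`w ∈ N(𝔸_F)` is upper unitriangular). [cite: Rogawski1990, §1.10] -/
theorem coe_adelicVal_apply_of_not_lt (hc : c * c = 1) (w : adelicUnipotent F E c 3) (i j : Fin 3) (hij : ¬ i < j) :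
    ((adelicVal F E c 3 _ (w : (quasiSplit F E c 3).Adelic) : GL (Fin 3) (AdeleRing (𝓞 E) E)) : Matrix (Fin 3) (Fin 3) (AdeleRing (𝓞 E) E)) i j =
      if i = j then 1 else 0 := by
  rw [coe_adelicVal_eq_one_add_single hc w]
  fin_cases i <;> fin_cases j <;> simp at hij ⊢

/-- **`(π w)_f ∈ K_f(𝔫)`** for `w ∈ N(𝔸_F)` whose off-diagonal entries `e` satisfy `|e_v| ≤ |𝔫|_v` and `|c(e)_v| ≤ |𝔫|_v` at every finite place `v`
(the inverse `(π w)⁻¹ = J ᵗc(π w) J` has entries `c(e)`). [cite: Rogawski1990, §2.2 (p. 13)] -/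
theorem sndHom_adelicVal_mem_comap_principalCongruenceLevel (hc : c * c = 1) (w : adelicUnipotent F E c 3) (𝔫 : Ideal (𝓞 E))
    (hval : ∀ i j : Fin 3, i ≠ j → ∀ v : HeightOneSpectrum (𝓞 E),
      Valued.v ((((adelicVal F E c 3 _ (w : (quasiSplit F E c 3).Adelic) : GL (Fin 3) (AdeleRing (𝓞 E) E)) :
          Matrix (Fin 3) (Fin 3) (AdeleRing (𝓞 E) E)) i j).2 v) ≤ idealRadius E v 𝔫 ∧
      Valued.v ((conjAdele F E c (((adelicVal F E c 3 _ (w : (quasiSplit F E c 3).Adelic) : GL (Fin 3) (AdeleRing (𝓞 E) E)) :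
          Matrix (Fin 3) (Fin 3) (AdeleRing (𝓞 E) E)) i j)).2 v) ≤ idealRadius E v 𝔫) :
    GLn.sndHom 3 E (adelicVal F E c 3 _ (w : (quasiSplit F E c 3).Adelic)) ∈ (principalCongruenceLevel 3 E 𝔫).comap (GLn.ofFinite 3 E) := by
  rw [mem_comap_principalCongruenceLevel_iff_localComponent]
  intro v
  set g : GL (Fin 3) (AdeleRing (𝓞 E) E) := adelicVal F E c 3 _ (w : (quasiSplit F E c 3).Adelic) with hg
  have hinv : ∀ i j, ((g⁻¹ : GL (Fin 3) (AdeleRing (𝓞 E) E)) : Matrix (Fin 3) (Fin 3) (AdeleRing (𝓞 E) E)) i j =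
      conjAdele F E c ((g : Matrix (Fin 3) (Fin 3) (AdeleRing (𝓞 E) E)) (Fin.rev j) (Fin.rev i)) := fun i j =>
    coe_inv_apply_of_mem_unitaryGroupOfForm_antidiagonal (conjAdele F E c) 3 (adelicVal_mem_unitaryGroupOfForm (w : (quasiSplit F E c 3).Adelic)) i j
  have hrev : ∀ i j : Fin 3, i ≠ j → Fin.rev j ≠ Fin.rev i := fun i j hij h => hij (Fin.rev_injective h).symm
  -- entries of the local component
  have hent : ∀ (x : GL (Fin 3) (AdeleRing (𝓞 E) E)) (i j : Fin 3),
      (localComponent 3 E v (GLn.sndHom 3 E x) : Matrix (Fin 3) (Fin 3) (v.adicCompletion E)) i j =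
        ((x : Matrix (Fin 3) (Fin 3) (AdeleRing (𝓞 E) E)) i j).2 v := fun x i j => rfl
  have hone : ((1 : AdeleRing (𝓞 E) E).2) v = 1 := rfl
  refine mem_valuedCongruenceSubgroup_of_entries (idealRadius_le_one' (K := E) v 𝔫) (fun i => ?_) (fun i => ?_) (fun i j hij => ?_)
    (fun i j hij => ?_)
  · rw [hent, coe_adelicVal_apply_of_not_lt hc w i i (lt_irrefl i), if_pos rfl, hone]
  · rw [← map_inv, ← map_inv, hent, hinv, coe_adelicVal_apply_of_not_lt hc w _ _ (lt_irrefl _), if_pos rfl, map_one, hone]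
  · rw [hent]
    exact (hval i j hij v).1
  · rw [← map_inv, ← map_inv, hent, hinv]
    exact (hval _ _ (hrev i j hij) v).2

/-- **`ιf(κ_f⁻¹ (π w)_f κ_f) ∈ K(𝔫)`** for `κ_f ∈ GL₃(𝒪̂_E)` under the same divisibility hypothesis (`K_f(𝔫)` is normal in `GL₃(𝒪̂)`,
★ `BigHeckeGLn.conj_mem_comap_principalCongruenceLevel`). This is the level factor of the three-factor normal form ★ `adelicVal_borel_mul_conj_eq_threeFactor`.
[cite: Rogawski1990, §2.2 (p. 13)] -/
theorem ofFinite_conj_sndHom_mem_principalCongruenceLevel (hc : c * c = 1) (w : adelicUnipotent F E c 3) (𝔫 : Ideal (𝓞 E))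
    (hval : ∀ i j : Fin 3, i ≠ j → ∀ v : HeightOneSpectrum (𝓞 E),
      Valued.v ((((adelicVal F E c 3 _ (w : (quasiSplit F E c 3).Adelic) : GL (Fin 3) (AdeleRing (𝓞 E) E)) :
          Matrix (Fin 3) (Fin 3) (AdeleRing (𝓞 E) E)) i j).2 v) ≤ idealRadius E v 𝔫 ∧
      Valued.v ((conjAdele F E c (((adelicVal F E c 3 _ (w : (quasiSplit F E c 3).Adelic) : GL (Fin 3) (AdeleRing (𝓞 E) E)) :
          Matrix (Fin 3) (Fin 3) (AdeleRing (𝓞 E) E)) i j)).2 v) ≤ idealRadius E v 𝔫)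
    {κf : GL (Fin 3) (FiniteAdeleRing (𝓞 E) E)} (hκ : κf ∈ glFiniteIntegralLevel 3 E) :
    GLn.ofFinite 3 E (κf⁻¹ * GLn.sndHom 3 E (adelicVal F E c 3 _ (w : (quasiSplit F E c 3).Adelic)) * κf) ∈
      principalCongruenceLevel 3 E 𝔫 := by
  have h := conj_mem_comap_principalCongruenceLevel (inv_mem hκ) (sndHom_adelicVal_mem_comap_principalCongruenceLevel hc w 𝔫 hval)
  rw [inv_inv] at h
  exact h

/-! ## §3 `c`-stable levels: the conjugate condition is automatic -/

omit [NumberField F] in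
/-- The radius `|𝔫|_w` is Galois-invariant: `|σ • 𝔫|_{σ w} = |𝔫|_w` (the tree's `idealRadius_smul` of `AutomorphicGaloisConj`, restated privately to keep the
imports light). [folklore] -/
private theorem idealRadius_smul' (σ : E ≃ₐ[F] E) (w : HeightOneSpectrum (𝓞 E)) (𝔫 : Ideal (𝓞 E)) :
    idealRadius E (σ • w) (σ • 𝔫) = idealRadius E w 𝔫 := by
  classical
  rcases eq_or_ne 𝔫 ⊥ with rfl | h𝔫
  · rw [Ideal.smul_bot, idealRadius, idealRadius, FractionalIdeal.coeIdeal_bot, FractionalIdeal.count_zero,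
      FractionalIdeal.count_zero]
  · have hσ𝔫 : σ • 𝔫 ≠ ⊥ := fun h => h𝔫 ((Ideal.smul_eq_bot_iff σ 𝔫).mp h)
    rw [idealRadius, idealRadius, FractionalIdeal.count_coe E _ hσ𝔫, FractionalIdeal.count_coe E _ h𝔫,
      HeightOneSpectrum.count_smul_asIdeal σ w h𝔫]

omit [NumberField F] in
/-- For a `c`-stable ideal `𝔫` (`c • 𝔫 = 𝔫`): `|c(e)_v| ≤ |𝔫|_v` for all `v` as soon as `|e_v| ≤ |𝔫|_v` for all `v` (`c(e)_v = c_*(e_{c⁻¹ v})` has the valuation of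
`e_{c⁻¹v}`, ★ `valued_galAdicCompletionMap`, and `|𝔫|_{c⁻¹v} = |c⁻¹ • 𝔫|_{c⁻¹ v} = |𝔫|_v`). [cite: CasselsFrohlichANT1967, Ch. VII §1.1] -/
theorem valued_conjAdele_snd_le_of_smul_eq {𝔫 : Ideal (𝓞 E)} (h𝔫 : c • 𝔫 = 𝔫) {e : AdeleRing (𝓞 E) E}
    (he : ∀ v : HeightOneSpectrum (𝓞 E), Valued.v (e.2 v) ≤ idealRadius E v 𝔫) (v : HeightOneSpectrum (𝓞 E)) :
    Valued.v ((conjAdele F E c e).2 v) ≤ idealRadius E v 𝔫 := by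
  rw [conjAdele_apply, AdeleRing.smul_snd, FiniteAdeleRing.smul_apply, valued_galAdicCompletionMap]
  have hrad : idealRadius E (c⁻¹ • v) 𝔫 = idealRadius E v 𝔫 := by
    have h1 : c⁻¹ • 𝔫 = 𝔫 := by
      conv_lhs => rw [← h𝔫]
      rw [inv_smul_smul]
    have := idealRadius_smul' (F := F) c⁻¹ v 𝔫
    rw [h1] at this
    exact this
  rw [← hrad]
  exact he _

/-- **`(π w)_f ∈ K_f(𝔫)` for a `c`-stable `𝔫`** from the divisibility of the off-diagonal entries of `π w` alone. [cite: Rogawski1990, §2.2 (p. 13)] -/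
theorem sndHom_adelicVal_mem_comap_principalCongruenceLevel_of_smul_eq (hc : c * c = 1) (w : adelicUnipotent F E c 3)
    {𝔫 : Ideal (𝓞 E)} (h𝔫 : c • 𝔫 = 𝔫)
    (hval : ∀ i j : Fin 3, i ≠ j → ∀ v : HeightOneSpectrum (𝓞 E),
      Valued.v ((((adelicVal F E c 3 _ (w : (quasiSplit F E c 3).Adelic) : GL (Fin 3) (AdeleRing (𝓞 E) E)) :
          Matrix (Fin 3) (Fin 3) (AdeleRing (𝓞 E) E)) i j).2 v) ≤ idealRadius E v 𝔫) :
    GLn.sndHom 3 E (adelicVal F E c 3 _ (w : (quasiSplit F E c 3).Adelic)) ∈ (principalCongruenceLevel 3 E 𝔫).comap (GLn.ofFinite 3 E) :=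
  sndHom_adelicVal_mem_comap_principalCongruenceLevel hc w 𝔫 fun i j hij v =>
    ⟨hval i j hij v, valued_conjAdele_snd_le_of_smul_eq h𝔫 (hval i j hij) v⟩

/-- **`ιf(κ_f⁻¹ (π w)_f κ_f) ∈ K(𝔫)`, `c`-stable `𝔫`, `κ_f ∈ GL₃(𝒪̂_E)`.** [cite: Rogawski1990, §2.2 (p. 13)] -/
theorem ofFinite_conj_sndHom_mem_principalCongruenceLevel_of_smul_eq (hc : c * c = 1) (w : adelicUnipotent F E c 3)
    {𝔫 : Ideal (𝓞 E)} (h𝔫 : c • 𝔫 = 𝔫)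
    (hval : ∀ i j : Fin 3, i ≠ j → ∀ v : HeightOneSpectrum (𝓞 E),
      Valued.v ((((adelicVal F E c 3 _ (w : (quasiSplit F E c 3).Adelic) : GL (Fin 3) (AdeleRing (𝓞 E) E)) :
          Matrix (Fin 3) (Fin 3) (AdeleRing (𝓞 E) E)) i j).2 v) ≤ idealRadius E v 𝔫)
    {κf : GL (Fin 3) (FiniteAdeleRing (𝓞 E) E)} (hκ : κf ∈ glFiniteIntegralLevel 3 E) :
    GLn.ofFinite 3 E (κf⁻¹ * GLn.sndHom 3 E (adelicVal F E c 3 _ (w : (quasiSplit F E c 3).Adelic)) * κf) ∈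
      principalCongruenceLevel 3 E 𝔫 :=
  ofFinite_conj_sndHom_mem_principalCongruenceLevel hc w 𝔫
    (fun i j hij v => ⟨hval i j hij v, valued_conjAdele_snd_le_of_smul_eq h𝔫 (hval i j hij) v⟩) hκ

end UnitaryGroup

end Literature.NumberTheory.Automorphic

end
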